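import Literature.NumberTheory.GaloisRepresentations.PresentationGaloisModules
import Literature.NumberTheory.GaloisRepresentations.HomDualReadoutRestrict
import Literature.NumberTheory.GaloisRepresentations.GalLayerSystemUnitsBar
import Literature.NumberTheory.GaloisRepresentations.GalLayerSystemSES
import HarnessLib

/-!
# The idèle READOUT of the presentation road: `R_v f = (ρ^∨(1)|_v ≅ Hom(M|_v, K̄_vˣ))⁻¹ δ₀^{K_v}(π_v ∘ f)`
# for `f : N₁ ⟶ J̄`, from an idèle projection `π_v : J̄ → K̄_vˣ`; properties (R1) and (R2)

Topic `NumberTheory/GaloisRepresentations`; namespace `Literature.NumberTheory.GaloisRepresentations.HomDual`.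
Definitions with bodies (the datum `IdeleProjection`, the readout maps) and theorems; no named fact, no instance,
no `sorry`.  Sequel to `PresentationGaloisModules` (the `C_Γ ↔ DGM` bridge: `toDGM`, `pres_isSES`),
`HomDualPresentation` (`dualδ₀`), `HomDualReadoutRestrict` (`tateDualRestrictUnitsIso`, `localization_dualδ₀_eq_place`),
`GalLayerSystemSES` (`ideleBarD`, `unitsToIdele`) and `GalLayerSystemUnitsBar` (`unitsBarAddEquiv : lim→ Eˣ ≃+ K̄ˣ`).

THE MATHEMATICS (Milne, *ADT* I, proof of Lemma 4.13 / Thm. 4.10, at the level of homomorphisms; door-c6 g16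
FINDING §5 (R-def)).  Let `K` be a number field, `v` a place, `K_v = Place.Completion v`, `ι_v : K̄ → K̄_v` the tree's
chosen embedding with `res_v : Γ_{K_v} → Γ_K` (`absClosureEmbedding`, `absGaloisRestrict`), and `J̄ = lim→_E J_E` door-c5's
idèle module (`ideleBarD K`, an object of `C_Γ`).  An **idèle projection at `v`** (`IdeleProjection K v`) is an additive
`π_v : J̄ → K̄_vˣ` which is `res_v`-equivariant and restricts to `ι_v` on the principal idèles `lim→ Eˣ = K̄ˣ`
(intended: "the `w_v`-component followed by `E_{w_v} ↪ K̄_v`", to be constructed by door-c5 from `placeProj` /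
`exists_place_algHom_compositum`; this file is agnostic about the construction).  Given `π_v`:
* for every `X : C_Γ` and `f : X ⟶ J̄`, `π_v ∘ f : X|_{Γ_{K_v}} → K̄_vˣ` is `Γ_{K_v}`-equivariant (`readoutInvariant`),
  additive in `f` (`readoutInvariantHom`), and for `h : X ⟶ K̄ˣ` (= `unitsBarD K`), `π_v ∘ (h ≫ (K̄ˣ → J̄)) = ι_v ∘ h`
  (`readoutInvariant_comp_unitsToIdele`: it is the `transferInvariant` of door-c6 g16's `(R2)` files);
* for the presentation `0 → N₁ → P → M → 0` of a finite `n`-torsion `ρ` on `M` (`FreePresentation.presentationComplex ρ`),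
  **`readout ρ n hM π : Hom_{C_Γ}(N₁, J̄) →+ H¹(K_v, ρ^∨(1))`**, `f ↦ H¹(e_v⁻¹)(δ₀^{K_v}(π_v ∘ f))` with
  `e_v = tateDualRestrictUnitsIso : ρ^∨(1)|_v ≅ Hom_ℤ(M|_v, K̄_vˣ)`;
* **(R1)** `readout_f_comp : readout (S.f ≫ q) = 0` for every `q : P ⟶ J̄` (`dualδ₀_precomp_eq_zero`);
* **(R2)** `readout_comp_unitsToIdele : readout (h ≫ (K̄ˣ → J̄)) = loc_v (globalClass h)` for every `h : N₁ ⟶ K̄ˣ`, where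
  `globalClass h = H¹(e⁻¹)(δ₀^{K}(h)) ∈ H¹(K, ρ^∨(1))` (`localization_dualδ₀_eq_place`).
These are, verbatim, the data `R` and the hypotheses `hR1`, `hR2` of the Summits theorem
`middleExact_allPlaces_of_readout` (module `ρ := ρ₀.tateDual n`, presentation of `ρ₀`), for ANY family `(π_v)_v`.
HONEST FRAMING: no case of Poitou–Tate or BSD is proved here; (R3) (assembly / surjectivity) and (R4) (pairing
dictionary) are not addressed.

## References
* J. S. Milne, *Arithmetic Duality Theorems* (2nd ed. 2006), I §0, I Lemma 4.13 and Thm. 4.10 (proof, p. 58). [MilneADT2006]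
* J. W. S. Cassels, A. Fröhlich (eds.), *Algebraic Number Theory* (1967), Ch. VII (Tate) §8 Prop. 8.1, §9.7. [CasselsFrohlichANT1967]
* J. Neukirch, A. Schmidt, K. Wingberg, *Cohomology of Number Fields* (2008), (1.5.2). [NeukirchSchmidtWingberg2008]
-/

noncomputable section

open CategoryTheory CategoryTheory.Limits NumberField
open Field (absoluteGaloisGroup)
open scoped ContRepresentation

namespace Literature.NumberTheory.GaloisRepresentations

namespace HomDual

open Literature.Algebra.Homology Literature.Algebra.Homology.DiscreteRep DiscreteGaloisModule IdeleClassBar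
  FreePresentation DGMBridge

/-! ## §1 Idèle projections at a place -/

section Datum

variable (K : Type) [Field K] [NumberField K] (v : Place K)

/-- **An idèle projection at the place `v`**: an additive map `π_v : J̄ = lim→ J_E → K̄_vˣ` which is equivariant along
`res_v : Γ_{K_v} → Γ_K` and restricts to the chosen embedding `ι_v : K̄ˣ → K̄_vˣ` on the principal idèles `lim→ Eˣ ≃ K̄ˣ`.
(Intended model: the component at the place `w_v ∣ v` singled out by `ι_v`, followed by `E_{w_v} ↪ K̄_v`.)
[cite: MilneADT2006, I Lemma 4.13 (proof)][cite: CasselsFrohlichANT1967, Ch. VII §9.7] -/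
structure IdeleProjection where
  /-- The underlying additive map `J̄ → K̄_vˣ`. -/
  toAddMonoidHom : (ideleData K).toSystem.limit →+ UnitsCarrier (Place.Completion v)
  /-- `res_v`-equivariance: `π_v ((res_v σ) • z) = σ • π_v z`. -/
  map_rep' : ∀ (σ : absoluteGaloisGroup (Place.Completion v)) (z : (ideleData K).toSystem.limit),
    toAddMonoidHom ((ideleData K).toSystem.rep (absGaloisRestrict K (Place.Completion v) σ) z) =
      units (Place.Completion v) σ (toAddMonoidHom z)
  /-- On principal idèles `π_v` is `ι_v : K̄ˣ → K̄_vˣ`. -/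
  map_unitsToIdele' : ∀ u : (unitsData K).toSystem.limit,
    toAddMonoidHom ((unitsToIdele K).limitMap u) = unitsTransferAddHom K (Place.Completion v) (unitsBarAddEquiv K u)

variable {K v}

/-- `res_v`-equivariance of an idèle projection. [cite: MilneADT2006, I Lemma 4.13 (proof)] -/
theorem IdeleProjection.map_rep (π : IdeleProjection K v) (σ : absoluteGaloisGroup (Place.Completion v))
    (z : (ideleData K).toSystem.limit) :
    π.toAddMonoidHom ((ideleData K).toSystem.rep (absGaloisRestrict K (Place.Completion v) σ) z) =
      units (Place.Completion v) σ (π.toAddMonoidHom z) :=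
  π.map_rep' σ z

/-- An idèle projection is `ι_v` on principal idèles. [cite: MilneADT2006, I Lemma 4.13 (proof)] -/
theorem IdeleProjection.map_unitsToIdele (π : IdeleProjection K v) (u : (unitsData K).toSystem.limit) :
    π.toAddMonoidHom ((unitsToIdele K).limitMap u) = unitsTransferAddHom K (Place.Completion v) (unitsBarAddEquiv K u) :=
  π.map_unitsToIdele' u

end Datum

/-! ## §2 `π_v ∘ f` for `f : X ⟶ J̄`, and `ι ∘ h` for `h : X ⟶ K̄ˣ` -/

section Maps

variable {K : Type} [Field K] [NumberField K] {v : Place K} (π : IdeleProjection K v)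
variable (X Y : DiscreteRepCat ℤ (absoluteGaloisGroup K)) [Module.Finite ℤ (LCarrier X)] [Module.Finite ℤ (LCarrier Y)]

/-- **`π_v ∘ f : X → K̄_vˣ`** for a `C_Γ`-morphism `f : X ⟶ J̄`, on the discrete carrier `LCarrier X`.
[cite: MilneADT2006, I Lemma 4.13 (proof)] -/
def readoutMap (f : X ⟶ ideleBarD K) : LCarrier X →ₗ[ℤ] UnitsCarrier (Place.Completion v) :=
  (π.toAddMonoidHom.comp ((f.hom.hom : X.obj.V →+ (ideleBarD K).obj.V).comp (LCarrier.val X))).toIntLinearMap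

omit [Module.Finite ℤ (LCarrier X)] in
/-- Unfolding `readoutMap`. [cite: MilneADT2006, I Lemma 4.13 (proof)] -/
@[simp] theorem readoutMap_apply (f : X ⟶ ideleBarD K) (x : LCarrier X) :
    readoutMap π X f x = π.toAddMonoidHom (f.hom.hom (LCarrier.val X x)) := rfl

omit [Module.Finite ℤ (LCarrier X)] in
/-- **`π_v ∘ f` is `Γ_{K_v}`-equivariant** (for `X|_{Γ_{K_v}}` and `K̄_vˣ`). [cite: MilneADT2006, I Lemma 4.13 (proof)] -/
theorem readoutMap_smul (f : X ⟶ ideleBarD K) (σ : absoluteGaloisGroup (Place.Completion v)) (x : LCarrier X) :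
    readoutMap π X f (((toDGM X).restrictField (Place.Completion v)) σ x) =
      units (Place.Completion v) σ (readoutMap π X f x) := by
  rw [GaloisRep.restrictField_apply, readoutMap_apply, readoutMap_apply, toDGM_apply, LCarrier.val_of,
    ← π.map_rep]
  exact congrArg π.toAddMonoidHom (Rep.hom_comm_apply f.hom _ _)

/-- **`π_v ∘ f` as an invariant of `Hom_ℤ(X|_v, K̄_vˣ)`** (an equivariant homomorphism). [cite: MilneADT2006, I Lemma 4.13 (proof)] -/
def readoutInvariant (f : X ⟶ ideleBarD K) :
    (homGaloisModule ((toDGM X).restrictField (Place.Completion v)) (units (Place.Completion v))).toTopRep.ρ.invariants :=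
  invariantOfEquivariant _ _ (readoutMap π X f) (readoutMap_smul π X f)

/-- Unfolding `readoutInvariant`. [cite: MilneADT2006, I Lemma 4.13 (proof)] -/
@[simp] theorem coe_readoutInvariant (f : X ⟶ ideleBarD K) :
    ((readoutInvariant π X f).1 : DiscreteRep.HomCarrier (LCarrier X) (UnitsCarrier (Place.Completion v))) =
      readoutMap π X f := rfl

/-- **`f ↦ π_v ∘ f` is additive in `f`.** [cite: MilneADT2006, I Lemma 4.13 (proof)] -/
def readoutInvariantHom :
    (X ⟶ ideleBarD K) →+
      (homGaloisModule ((toDGM X).restrictField (Place.Completion v)) (units (Place.Completion v))).toTopRep.ρ.invariants where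
  toFun := readoutInvariant π X
  map_zero' := Subtype.ext (LinearMap.ext fun x => by
    change π.toAddMonoidHom ((0 : X ⟶ ideleBarD K).hom.hom (LCarrier.val X x)) = 0
    rw [← map_zero π.toAddMonoidHom]
    rfl)
  map_add' f g := Subtype.ext (LinearMap.ext fun x => by
    change π.toAddMonoidHom ((f + g).hom.hom (LCarrier.val X x)) =
      π.toAddMonoidHom (f.hom.hom (LCarrier.val X x)) + π.toAddMonoidHom (g.hom.hom (LCarrier.val X x))
    rw [← map_add]
    rfl)

/-- Unfolding `readoutInvariantHom`. [cite: MilneADT2006, I Lemma 4.13 (proof)] -/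
@[simp] theorem readoutInvariantHom_apply (f : X ⟶ ideleBarD K) : readoutInvariantHom π X f = readoutInvariant π X f := rfl

/-- **(R1) at the level of maps**: `π_v ∘ (i ≫ q) = (π_v ∘ q) ∘ i` is the precomposition of the invariant of `q`.
[cite: MilneADT2006, I Lemma 4.13 (proof)] -/
theorem coe_readoutInvariant_comp (i : X ⟶ Y) (q : Y ⟶ ideleBarD K) :
    ((readoutInvariant π X (i ≫ q)).1 : DiscreteRep.HomCarrier (LCarrier X) (UnitsCarrier (Place.Completion v))) =
      precomp ((toDGM X).restrictField (Place.Completion v)) ((toDGM Y).restrictField (Place.Completion v))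
        (units (Place.Completion v)) (restrictIntertwining (toDGM X) (toDGM Y) (lmap X Y i)) (readoutInvariant π Y q) :=
  LinearMap.ext fun _ => rfl

/-- **`ι ∘ h : X → K̄ˣ`** for a `C_Γ`-morphism `h : X ⟶ lim→ Eˣ` (through door-c5's `unitsBarAddEquiv : lim→ Eˣ ≃+ K̄ˣ`).
[cite: MilneADT2006, I Lemma 4.13 (proof)] -/
def unitsMap (h : X ⟶ unitsBarD K) : LCarrier X →ₗ[ℤ] UnitsCarrier K :=
  ((unitsBarAddEquiv K).toAddMonoidHom.comp ((h.hom.hom : X.obj.V →+ (unitsBarD K).obj.V).comp (LCarrier.val X))).toIntLinearMap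

omit [Module.Finite ℤ (LCarrier X)] in
/-- Unfolding `unitsMap`. [cite: MilneADT2006, I Lemma 4.13 (proof)] -/
@[simp] theorem unitsMap_apply (h : X ⟶ unitsBarD K) (x : LCarrier X) :
    unitsMap X h x = unitsBarAddEquiv K (h.hom.hom (LCarrier.val X x)) := rfl

omit [Module.Finite ℤ (LCarrier X)] in
/-- `ι ∘ h` is `Γ_K`-equivariant. [cite: MilneADT2006, I Lemma 4.13 (proof)] -/
theorem unitsMap_smul (h : X ⟶ unitsBarD K) (σ : absoluteGaloisGroup K) (x : LCarrier X) :
    unitsMap X h (toDGM X σ x) = units K σ (unitsMap X h x) := by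
  rw [unitsMap_apply, unitsMap_apply, toDGM_apply, LCarrier.val_of, ← unitsBarAddEquiv_rep]
  exact congrArg (unitsBarAddEquiv K) (Rep.hom_comm_apply h.hom _ _)

/-- **`ι ∘ h` as an invariant of `Hom_ℤ(X, K̄ˣ)`.** [cite: MilneADT2006, I Lemma 4.13 (proof)] -/
def unitsInvariant (h : X ⟶ unitsBarD K) : (homGaloisModule (toDGM X) (units K)).toTopRep.ρ.invariants :=
  invariantOfEquivariant _ _ (unitsMap X h) (unitsMap_smul X h)

/-- Unfolding `unitsInvariant`. [cite: MilneADT2006, I Lemma 4.13 (proof)] -/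
@[simp] theorem coe_unitsInvariant (h : X ⟶ unitsBarD K) :
    ((unitsInvariant X h).1 : DiscreteRep.HomCarrier (LCarrier X) (UnitsCarrier K)) = unitsMap X h := rfl

/-- **(R2) at the level of maps**: `π_v ∘ (h ≫ (K̄ˣ → J̄)) = ι_v ∘ (ι ∘ h)`, i.e. the readout invariant of `h ≫ unitsToIdele`
is the TRANSFER (`transferInvariant` along `unitsTransfer K K_v`) of the invariant of `h`. [cite: MilneADT2006, I Lemma 4.13 (proof)] -/
theorem readoutInvariant_comp_unitsToIdele (h : X ⟶ unitsBarD K) :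
    readoutInvariant π X (h ≫ (unitsToIdele K).limitHom) =
      transferInvariant (toDGM X) (units K) (units (Place.Completion v)) (unitsTransfer K (Place.Completion v))
        (unitsInvariant X h) := by
  refine Subtype.ext (LinearMap.ext fun x => ?_)
  change π.toAddMonoidHom ((unitsToIdele K).limitMap (h.hom.hom (LCarrier.val X x))) =
    unitsTransfer K (Place.Completion v) (unitsBarAddEquiv K (h.hom.hom (LCarrier.val X x)))
  rw [π.map_unitsToIdele, unitsTransfer_apply]

end Maps

/-! ## §3 The readout of the presentation of a finite Galois module, (R1) and (R2) -/

section Presentation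

variable {K : Type} [Field K] [NumberField K]
variable {M : Type} [AddCommGroup M] [TopologicalSpace M] [DiscreteTopology M] [Finite M]
variable (ρ : DiscreteGaloisModule K M) (n : ℕ) [NeZero n]

/-- **The readout `R_v : Hom_{C_Γ}(N₁, J̄) →+ H¹(K_v, ρ^∨(1))`**, `f ↦ H¹(e_v⁻¹)(δ₀^{K_v}(π_v ∘ f))`, for the presentation
`0 → N₁ → P → M → 0` of `ρ` (door-c4's `presentationComplex ρ`), `e_v = tateDualRestrictUnitsIso : ρ^∨(1)|_v ≅ Hom_ℤ(M|_v, K̄_vˣ)`.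
Its values live in `galoisCohomology ((ρ.tateDual n).toLocal v) 1` — the type of the datum `R v` of
`middleExact_allPlaces_of_readout` with module `ρ.tateDual n`. [cite: MilneADT2006, I Lemma 4.13 (proof), Thm. 4.10 (proof, p. 58)] -/
def readout (hM : ∀ m : M, n • m = 0) {v : Place K} (π : IdeleProjection K v) :
    ((presentationComplex ρ).X₁ ⟶ ideleBarD K) →+ galoisCohomology ((ρ.tateDual n).toLocal v) 1 :=
  haveI := moduleFinite_presModule₁ ρ
  haveI := moduleFinite_presModule₂ ρ
  haveI : CharZero (Place.Completion v) := charZero_of_algebra (K := K) (Place.Completion v)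
  (cohomologyMap (tateDualRestrictUnitsIso K (Place.Completion v) ρ n hM).inv 1).hom.toLinearMap.toAddMonoidHom.comp
    ((dualδ₀ ((presModule₁ ρ).restrictField (Place.Completion v)) ((presModule₂ ρ).restrictField (Place.Completion v))
        (ρ.restrictField (Place.Completion v)) (units (Place.Completion v))
        (restrictIntertwining (presModule₁ ρ) (presModule₂ ρ) (presIncl ρ))
        (restrictIntertwining (presModule₂ ρ) ρ (presProj ρ))
        (isSES_restrict (presModule₁ ρ) (presModule₂ ρ) ρ (pres_isSES ρ))
        (baer_unitsCarrier (Place.Completion v))).comp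
      (readoutInvariantHom π (presentationComplex ρ).X₁))

/-- Unfolding `readout`. [cite: MilneADT2006, I Lemma 4.13 (proof)] -/
theorem readout_apply (hM : ∀ m : M, n • m = 0) {v : Place K} (π : IdeleProjection K v)
    (f : (presentationComplex ρ).X₁ ⟶ ideleBarD K) :
    readout ρ n hM π f =
      haveI := moduleFinite_presModule₁ ρ
      haveI := moduleFinite_presModule₂ ρ
      haveI : CharZero (Place.Completion v) := charZero_of_algebra (K := K) (Place.Completion v)
      cohomologyMap (tateDualRestrictUnitsIso K (Place.Completion v) ρ n hM).inv 1
        (dualδ₀ ((presModule₁ ρ).restrictField (Place.Completion v)) ((presModule₂ ρ).restrictField (Place.Completion v))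
          (ρ.restrictField (Place.Completion v)) (units (Place.Completion v))
          (restrictIntertwining (presModule₁ ρ) (presModule₂ ρ) (presIncl ρ))
          (restrictIntertwining (presModule₂ ρ) ρ (presProj ρ))
          (isSES_restrict (presModule₁ ρ) (presModule₂ ρ) ρ (pres_isSES ρ))
          (baer_unitsCarrier (Place.Completion v)) (readoutInvariant π (presentationComplex ρ).X₁ f)) := rfl

/-- **(R1)**: `R_v (S.f ≫ q) = 0` for every `q : P ⟶ J̄` (the readout of a map that extends to `P` vanishes:
`dualδ₀_precomp_eq_zero`).  This is hypothesis `hR1` of `middleExact_allPlaces_of_readout`.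
[cite: MilneADT2006, I Lemma 4.13 (proof)][cite: SerreGaloisCohomology1997, I §2.2] -/
theorem readout_f_comp (hM : ∀ m : M, n • m = 0) {v : Place K} (π : IdeleProjection K v)
    (q : (presentationComplex ρ).X₂ ⟶ ideleBarD K) :
    readout ρ n hM π ((presentationComplex ρ).f ≫ q) = 0 := by
  haveI := moduleFinite_presModule₁ ρ
  haveI := moduleFinite_presModule₂ ρ
  haveI : CharZero (Place.Completion v) := charZero_of_algebra (K := K) (Place.Completion v)
  rw [readout_apply, dualδ₀_precomp_eq_zero _ _ _ _ _ _ _ _ (readoutInvariant π (presentationComplex ρ).X₂ q)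
    (readoutInvariant π (presentationComplex ρ).X₁ ((presentationComplex ρ).f ≫ q))
    (coe_readoutInvariant_comp π _ _ (presentationComplex ρ).f q)]
  exact map_zero _

/-- **The global class of `h : N₁ ⟶ K̄ˣ`**: `H¹(e⁻¹)(δ₀^K(ι ∘ h)) ∈ H¹(K, ρ^∨(1))`, `e = tateDualUnitsIso : ρ^∨(1) ≅ Hom_ℤ(M, K̄ˣ)`.
[cite: MilneADT2006, I Lemma 4.13 (proof), Thm. 4.10 (proof, p. 58)] -/
def globalClass (hM : ∀ m : M, n • m = 0) (h : (presentationComplex ρ).X₁ ⟶ unitsBarD K) :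
    galoisCohomology (ρ.tateDual n) 1 :=
  haveI := moduleFinite_presModule₁ ρ
  haveI := moduleFinite_presModule₂ ρ
  cohomologyMap (tateDualUnitsIso K ρ n hM).inv 1
    (dualδ₀ (presModule₁ ρ) (presModule₂ ρ) ρ (units K) (presIncl ρ) (presProj ρ) (pres_isSES ρ) (baer_unitsCarrier K)
      (unitsInvariant (presentationComplex ρ).X₁ h))

/-- **(R2)**: `R_v (h ≫ (K̄ˣ → J̄)) = loc_v (globalClass h)` at EVERY place `v` (finite or infinite): the readout of a map
factoring through the principal idèles is the localisation of ONE global class.  This is hypothesis `hR2` of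
`middleExact_allPlaces_of_readout` (`localization_dualδ₀_eq_place` + `π_v ∘ unitsToIdele = ι_v`).
[cite: MilneADT2006, I Lemma 4.13 (proof), Thm. 4.10 (proof, p. 58)][cite: NeukirchSchmidtWingberg2008, (1.5.2)] -/
theorem readout_comp_unitsToIdele (hM : ∀ m : M, n • m = 0) {v : Place K} (π : IdeleProjection K v)
    (h : (presentationComplex ρ).X₁ ⟶ unitsBarD K) :
    readout ρ n hM π (h ≫ (ideleClassLimitShortComplex K).f) =
      galoisCohomology.localization (ρ.tateDual n) v 1 (globalClass ρ n hM h) := by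
  haveI := moduleFinite_presModule₁ ρ
  haveI := moduleFinite_presModule₂ ρ
  haveI : CharZero (Place.Completion v) := charZero_of_algebra (K := K) (Place.Completion v)
  rw [readout_apply, ideleClassLimitShortComplex_f, readoutInvariant_comp_unitsToIdele]
  exact (localization_dualδ₀_eq_place (presModule₁ ρ) (presModule₂ ρ) ρ (presIncl ρ) (presProj ρ) v n hM (pres_isSES ρ)
    (unitsInvariant (presentationComplex ρ).X₁ h)).symm

/-- **(R2) in the shape of `hR2`**: every `h : N₁ ⟶ K̄ˣ` has ONE global class whose localisations are the readouts of
`h ≫ (K̄ˣ → J̄)` at all places. [cite: MilneADT2006, I Thm. 4.10 (proof, p. 58)] -/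
theorem exists_forall_readout_comp_unitsToIdele_eq (hM : ∀ m : M, n • m = 0) (πs : ∀ v : Place K, IdeleProjection K v)
    (h : (presentationComplex ρ).X₁ ⟶ (ideleClassLimitShortComplex K).X₁) :
    ∃ x : galoisCohomology (ρ.tateDual n) 1, ∀ v : Place K,
      readout ρ n hM (πs v) (h ≫ (ideleClassLimitShortComplex K).f) = galoisCohomology.localization (ρ.tateDual n) v 1 x :=
  ⟨globalClass ρ n hM h, fun v => readout_comp_unitsToIdele ρ n hM (πs v) h⟩

/-- **(R1) in the shape of `hR1`.** [cite: MilneADT2006, I Thm. 4.10 (proof, p. 58)] -/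
theorem readout_f_comp' (hM : ∀ m : M, n • m = 0) (πs : ∀ v : Place K, IdeleProjection K v)
    (q : (presentationComplex ρ).X₂ ⟶ (ideleClassLimitShortComplex K).X₂) (v : Place K) :
    readout ρ n hM (πs v) ((presentationComplex ρ).f ≫ q) = 0 :=
  readout_f_comp ρ n hM (πs v) q

end Presentation

end HomDual

end Literature.NumberTheory.GaloisRepresentations

end
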